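import Summits.CriticalPhenomena.PercolationContinuityZ3.Theorems.PercNearOneGluingNoHeavyLowerTailKnQuestion8CoefficientwiseCoreClassKernelMixTwoArmsPrep

/-!
# Two-arm gluing for the chordless two-type inequality, II: the oriented case analysis

Support file (`--supports stmt-CriticalPhenomena-4575`, closed), prover `prim-cplus-coupling` (gen 71).  No definitions, no named
facts, no sorries; standard axioms.  Memo `prim-cplus-coupling/A5-COUPLING-gen71.md` §2 (the `r = 2` case of the chordless
two-type conjecture, item 6.4 of memo gen 70); preliminaries in `…KernelMixTwoArmsPrep`, the theorem in `…KernelMixTwoArms`.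

SETTING (block form).  A *block* is a finite preordered type with a least element `b`, a greatest element `t`, an involution `c`
with `c b = t` (the mirror), and two *levels* `D, B` (families avoiding `t`; lower on the `P` side) for which the single-block
('chorded', loop-glued) two-type inequality holds for every pair of upper families `A, C`:

  `#((A∖C)∩(D∖B)) + #((C∖A)∩(B∖D)) ≤ #((A∖C)∩T₁) + #((C∖A)∩T₂) + #(A∩C∩NE) + #(A∩C∩(NF∖(D∪B)))`        (X2₁)

with `T₁ = {x | c x ∈ D}`, `T₂ = {x | c x ∈ B}`, `NE = univ ∖ {b}`, `NF = univ ∖ {t}` (for cycle words this is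
`Bouquet.HBundle.x2` of the one-cycle bouquet).  The CHORDLESS two-block bouquet on `P × Q` has demand region
`{b_P} × NF_Q ∪ NF_P × {b_Q}` (one block fully blue, none fully red), supply region `{t_P} × NE_Q ∪ NE_P × {t_Q}`, levels
`{b_P} × D_Q ∪ D_P × {b_Q}` (consistent at the corner: `b_P ∈ D_P ↔ b_Q ∈ D_Q`); its two-type inequality for upper families
`A, C ⊆ P × Q`, split along the two arms (corner `(b_P,b_Q)` and apex `(t_P,t_Q)` counted with the `Q`-arm), is a statement about
the fibres `A₀ ⊆ A₁` of `A` over `b_P, t_P` (upper families of `Q`) and the rows `A⁰ ⊆ A¹` of `A` at `b_Q, t_Q` (upper families of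
`P`), coupled by `b_Q ∈ A₀ ↔ b_P ∈ A⁰`, `t_Q ∈ A₁ ↔ t_P ∈ A¹`, `A⁰ ≠ ∅ → A₁ = univ`, `A₀ ≠ ∅ → A¹ = univ` (a source on one arm
lies below the whole target column of the other arm) — and the same for `C`.

* `TwoArms.two_arms_core` — the block-form inequality under the ORIENTATION hypothesis (no bad source of type 2; or both types on
  the `P`-arm; or both on the `Q`-arm; or type 1 only on the `Q`-arm and type 2 only on the `P`-arm).  Proof: each arm alone
  satisfies its chorded inequality with the apex (`credits_mono`); if one arm carries both types, the coupling puts the OTHER arm's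
  target column inside `A ∩ C`, one unit of slack that pays for the doubly counted apex; with opposite single types the arm in `A`
  has slack because its fibre `A₀` contains `t_Q ∉ D_Q` but not `b_Q`; one type only is one-type Hall ((X2₁) with `C = ∅`).
[cite: KozmaNitzan2024, Questions 8–9 (§5.5 p. 36) (context); Harris 1960; Kleitman 1966]
-/

namespace Summit.CriticalPhenomena.PercolationContinuityZ3.Theorems.Coefficientwise.TwoArms

open Finset

variable {P Q : Type*} [Fintype P] [DecidableEq P] [Preorder P] [Fintype Q] [DecidableEq Q] [Preorder Q]

/-- **Oriented core of the two-arm theorem.**  The block-form inequality under the case hypothesis that covers: no bad source of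
type 2 at all; both types on the `P`-arm; both types on the `Q`-arm; type 1 only on the `Q`-arm and type 2 only on the `P`-arm.
(The remaining cases are these for the data with the roles of `(A, D)` and `(C, B)` exchanged; see `two_arms_blockForm`.) -/
theorem two_arms_core
    -- block `P` (the arm glued at `b_Q`; its corner source and apex credit are counted with the other arm)
    (bP tP : P) (cP : P → P) (DP BP : Finset P)
    (hbP : ∀ p, bP ≤ p) (hcP : Function.Involutive cP) (hcPb : cP bP = tP)
    (hDPl : IsLowerSet (DP : Set P)) (hBPl : IsLowerSet (BP : Set P)) (hDPt : tP ∉ DP) (hBPt : tP ∉ BP)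
    (hXP : ∀ A C : Finset P, IsUpperSet (A : Set P) → IsUpperSet (C : Set P) →
      ((A \ C) ∩ (DP \ BP)).card + ((C \ A) ∩ (BP \ DP)).card ≤
        ((A \ C) ∩ univ.filter (fun x => cP x ∈ DP)).card + ((C \ A) ∩ univ.filter (fun x => cP x ∈ BP)).card +
          (A ∩ C ∩ univ.erase bP).card + (A ∩ C ∩ (univ.erase tP \ (DP ∪ BP))).card)
    -- block `Q` (the arm glued at `b_P`)
    (bQ tQ : Q) (cQ : Q → Q) (DQ BQ : Finset Q)
    (htQ : ∀ q, q ≤ tQ) (hbtQ : bQ ≠ tQ) (hcQ : Function.Involutive cQ) (hcQb : cQ bQ = tQ)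
    (hDQt : tQ ∉ DQ) (hBQt : tQ ∉ BQ)
    (hXQ : ∀ A C : Finset Q, IsUpperSet (A : Set Q) → IsUpperSet (C : Set Q) →
      ((A \ C) ∩ (DQ \ BQ)).card + ((C \ A) ∩ (BQ \ DQ)).card ≤
        ((A \ C) ∩ univ.filter (fun x => cQ x ∈ DQ)).card + ((C \ A) ∩ univ.filter (fun x => cQ x ∈ BQ)).card +
          (A ∩ C ∩ univ.erase bQ).card + (A ∩ C ∩ (univ.erase tQ \ (DQ ∪ BQ))).card)
    -- consistency of the levels at the corner
    (hDc : bP ∈ DP ↔ bQ ∈ DQ) (hBc : bP ∈ BP ↔ bQ ∈ BQ)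
    -- fibres of `A, C` over `b_P ≤ t_P` (upper families of `Q`) and rows at `b_Q ≤ t_Q` (upper families of `P`)
    (AQb AQt CQb CQt : Finset Q) (APb APt CPb CPt : Finset P)
    (hAQb : IsUpperSet (AQb : Set Q)) (hCQb : IsUpperSet (CQb : Set Q))
    (hAPb : IsUpperSet (APb : Set P)) (hCPb : IsUpperSet (CPb : Set P))
    (hAQ : AQb ⊆ AQt) (hCQ : CQb ⊆ CQt) (hAP : APb ⊆ APt) (hCP : CPb ⊆ CPt)
    -- couplings (corner, apex, and 'a source on one arm lies below the other arm's target column')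
    (hA00 : bQ ∈ AQb ↔ bP ∈ APb) (hA11 : tQ ∈ AQt ↔ tP ∈ APt) (hC11 : tQ ∈ CQt ↔ tP ∈ CPt)
    (hAPQ : APb.Nonempty → AQt = univ) (hCPQ : CPb.Nonempty → CQt = univ)
    (hAQP : AQb.Nonempty → APt = univ) (hCQP : CQb.Nonempty → CPt = univ)
    -- orientation hypothesis
    (hcase : ((CQb \ AQb) ∩ (BQ \ DQ) = ∅ ∧ (((CPb \ APb) ∩ (BP \ DP)).erase bP) = ∅) ∨
      ((((APb \ CPb) ∩ (DP \ BP)).erase bP).Nonempty ∧ (((CPb \ APb) ∩ (BP \ DP)).erase bP).Nonempty) ∨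
      (((AQb \ CQb) ∩ (DQ \ BQ)).Nonempty ∧ ((CQb \ AQb) ∩ (BQ \ DQ)).Nonempty) ∨
      (((AQb \ CQb) ∩ (DQ \ BQ)).Nonempty ∧ (CQb \ AQb) ∩ (BQ \ DQ) = ∅ ∧
        (((CPb \ APb) ∩ (BP \ DP)).erase bP).Nonempty ∧ (((APb \ CPb) ∩ (DP \ BP)).erase bP) = ∅)) :
    ((AQb \ CQb) ∩ (DQ \ BQ)).card + ((CQb \ AQb) ∩ (BQ \ DQ)).card +
        (((APb \ CPb) ∩ (DP \ BP)).erase bP).card + (((CPb \ APb) ∩ (BP \ DP)).erase bP).card ≤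
      ((AQt \ CQt) ∩ univ.filter (fun x => cQ x ∈ DQ)).card + ((CQt \ AQt) ∩ univ.filter (fun x => cQ x ∈ BQ)).card +
          (AQt ∩ CQt ∩ univ.erase bQ).card +
        ((((APt \ CPt) ∩ univ.filter (fun x => cP x ∈ DP)).erase tP).card +
          (((CPt \ APt) ∩ univ.filter (fun x => cP x ∈ BP)).erase tP).card + ((APt ∩ CPt ∩ univ.erase bP).erase tP).card) +
        (AQb ∩ CQb ∩ (univ.erase tQ \ (DQ ∪ BQ))).card + ((APb ∩ CPb ∩ (univ.erase tP \ (DP ∪ BP))).erase bP).card := by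
  -- names
  set T1Q : Finset Q := univ.filter (fun x => cQ x ∈ DQ) with eT1Q
  set T2Q : Finset Q := univ.filter (fun x => cQ x ∈ BQ) with eT2Q
  set T1P : Finset P := univ.filter (fun x => cP x ∈ DP) with eT1P
  set T2P : Finset P := univ.filter (fun x => cP x ∈ BP) with eT2P
  set NEQ : Finset Q := univ.erase bQ with eNEQ
  set NEP : Finset P := univ.erase bP with eNEP
  set S1V : Finset Q := (AQb \ CQb) ∩ (DQ \ BQ) with hS1V
  set S2V : Finset Q := (CQb \ AQb) ∩ (BQ \ DQ) with hS2V
  set S1U : Finset P := ((APb \ CPb) ∩ (DP \ BP)).erase bP with hS1U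
  set S2U : Finset P := ((CPb \ APb) ∩ (BP \ DP)).erase bP with hS2U
  set XQ1 : Finset Q := (AQt \ CQt) ∩ T1Q with hXQ1
  set XQ2 : Finset Q := (CQt \ AQt) ∩ T2Q with hXQ2
  set XQ3 : Finset Q := AQt ∩ CQt ∩ NEQ with hXQ3
  set XP1 : Finset P := (APt \ CPt) ∩ T1P with hXP1
  set XP2 : Finset P := (CPt \ APt) ∩ T2P with hXP2
  set XP3 : Finset P := APt ∩ CPt ∩ NEP with hXP3
  set PV : Finset Q := AQb ∩ CQb ∩ (univ.erase tQ \ (DQ ∪ BQ)) with hPV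
  set PU : Finset P := (APb ∩ CPb ∩ (univ.erase tP \ (DP ∪ BP))).erase bP with hPU
  -- typed targets avoid the bottom
  have hT1Q : T1Q ⊆ NEQ := filter_mirror_subset_erase_bot cQ hcQb hDQt
  have hT2Q : T2Q ⊆ NEQ := filter_mirror_subset_erase_bot cQ hcQb hBQt
  have hT1P : T1P ⊆ NEP := filter_mirror_subset_erase_bot cP hcPb hDPt
  have hT2P : T2P ⊆ NEP := filter_mirror_subset_erase_bot cP hcPb hBPt
  have hemptyP : IsUpperSet ((∅ : Finset P) : Set P) := by rw [coe_empty]; exact isUpperSet_empty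
  have hemptyQ : IsUpperSet ((∅ : Finset Q) : Set Q) := by rw [coe_empty]; exact isUpperSet_empty
  -- the three credit families are pairwise disjoint (for `P`)
  have hd12 : Disjoint XP1 XP2 := by
    rw [disjoint_left]; intro x hx hx'
    exact (mem_sdiff.mp (mem_inter.mp hx').1).2 (mem_sdiff.mp (mem_inter.mp hx).1).1
  have hd13 : Disjoint XP1 XP3 := by
    rw [disjoint_left]; intro x hx hx'
    exact (mem_sdiff.mp (mem_inter.mp hx).1).2 (mem_inter.mp (mem_inter.mp hx').1).2
  have hd23 : Disjoint XP2 XP3 := by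
    rw [disjoint_left]; intro x hx hx'
    exact (mem_sdiff.mp (mem_inter.mp hx).1).2 (mem_inter.mp (mem_inter.mp hx').1).1
  -- (V0) the `Q`-arm satisfies its chorded inequality with the apex
  have hV0 : S1V.card + S2V.card ≤ XQ1.card + XQ2.card + XQ3.card + PV.card := by
    have h := hXQ AQb CQb hAQb hCQb
    rw [← hS1V, ← hS2V, ← hPV] at h
    have hm := credits_mono (T₁ := T1Q) (T₂ := T2Q) (NE := NEQ) hAQ hCQ hT1Q hT2Q
    rw [← hXQ1, ← hXQ2, ← hXQ3] at hm
    omega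
  -- (U0) the `P`-arm (corner removed) satisfies its chorded inequality with the apex
  have hU0 : S1U.card + S2U.card ≤ XP1.card + XP2.card + XP3.card + PU.card := by
    by_cases hb : bP ∈ APb ∩ CPb
    · have hA : APb = univ := upper_eq_univ_of_bot_mem hAPb hbP (mem_inter.mp hb).1
      have hC : CPb = univ := upper_eq_univ_of_bot_mem hCPb hbP (mem_inter.mp hb).2
      have h1 : S1U = ∅ := by rw [hS1U, hA, hC]; simp
      have h2 : S2U = ∅ := by rw [hS2U, hA, hC]; simp
      rw [h1, h2]; simp
    · have hPU' : PU = APb ∩ CPb ∩ (univ.erase tP \ (DP ∪ BP)) := by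
        rw [hPU]; exact erase_eq_of_notMem (fun h => hb (mem_inter.mp h).1)
      have h := hXP APb CPb hAPb hCPb
      have hm := credits_mono (T₁ := T1P) (T₂ := T2P) (NE := NEP) hAP hCP hT1P hT2P
      rw [← hXP1, ← hXP2, ← hXP3] at hm
      have e1 : S1U.card ≤ ((APb \ CPb) ∩ (DP \ BP)).card := card_erase_le
      have e2 : S2U.card ≤ ((CPb \ APb) ∩ (BP \ DP)).card := card_erase_le
      rw [hPU']; omega
  -- (R1) removing the apex from the `P`-credits costs at most one
  have hR1 : XP1.card + XP2.card + XP3.card ≤ (XP1.erase tP).card + (XP2.erase tP).card + (XP3.erase tP).card + 1 :=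
    card_three_le_erase_add_one hd12 hd13 hd23 tP
  -- (R2) … and nothing unless the apex is also a `Q`-credit
  have hR2 : XP1.card + XP2.card + XP3.card ≤
      (XP1.erase tP).card + (XP2.erase tP).card + (XP3.erase tP).card + (XQ1.card + XQ2.card + XQ3.card) := by
    have htT : tP ∈ T1P ↔ tQ ∈ T1Q := by
      rw [top_mem_filter_mirror_iff cP hcP hcPb, top_mem_filter_mirror_iff cQ hcQ hcQb]; exact hDc
    have htT2 : tP ∈ T2P ↔ tQ ∈ T2Q := by
      rw [top_mem_filter_mirror_iff cP hcP hcPb, top_mem_filter_mirror_iff cQ hcQ hcQb]; exact hBc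
    have htNE : tQ ∈ NEQ := mem_erase.mpr ⟨fun h => hbtQ h.symm, mem_univ _⟩
    by_cases h1 : tP ∈ XP1
    · have : tQ ∈ XQ1 := by
        obtain ⟨hac, ht⟩ := mem_inter.mp h1
        obtain ⟨ha, hc⟩ := mem_sdiff.mp hac
        exact mem_inter.mpr ⟨mem_sdiff.mpr ⟨hA11.mpr ha, fun h => hc (hC11.mp h)⟩, htT.mp ht⟩
      have : 1 ≤ XQ1.card := card_pos.mpr ⟨tQ, this⟩
      omega
    by_cases h2 : tP ∈ XP2
    · have : tQ ∈ XQ2 := by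
        obtain ⟨hca, ht⟩ := mem_inter.mp h2
        obtain ⟨hc, ha⟩ := mem_sdiff.mp hca
        exact mem_inter.mpr ⟨mem_sdiff.mpr ⟨hC11.mpr hc, fun h => ha (hA11.mp h)⟩, htT2.mp ht⟩
      have : 1 ≤ XQ2.card := card_pos.mpr ⟨tQ, this⟩
      omega
    by_cases h3 : tP ∈ XP3
    · have : tQ ∈ XQ3 := by
        obtain ⟨hac, _⟩ := mem_inter.mp h3
        obtain ⟨ha, hc⟩ := mem_inter.mp hac
        exact mem_inter.mpr ⟨mem_inter.mpr ⟨hA11.mpr ha, hC11.mpr hc⟩, htNE⟩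
      have : 1 ≤ XQ3.card := card_pos.mpr ⟨tQ, this⟩
      omega
    rw [erase_eq_of_notMem h1, erase_eq_of_notMem h2, erase_eq_of_notMem h3]; omega
  -- elementary facts used in the case analysis
  have hS1V_sub_A : S1V ⊆ AQb := fun x hx => (mem_sdiff.mp (mem_inter.mp hx).1).1
  have hS2V_sub_C : S2V ⊆ CQb := fun x hx => (mem_sdiff.mp (mem_inter.mp hx).1).1
  have hS1U_sub_A : S1U ⊆ APb := fun x hx => (mem_sdiff.mp (mem_inter.mp (mem_erase.mp hx).2).1).1
  have hS2U_sub_C : S2U ⊆ CPb := fun x hx => (mem_sdiff.mp (mem_inter.mp (mem_erase.mp hx).2).1).1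
  have hS1U_sub_D : S1U ⊆ DP := fun x hx => (mem_sdiff.mp (mem_inter.mp (mem_erase.mp hx).2).2).1
  have hS2U_sub_B : S2U ⊆ BP := fun x hx => (mem_sdiff.mp (mem_inter.mp (mem_erase.mp hx).2).2).1
  have hdV : Disjoint S1V S2V := by
    rw [disjoint_left]; intro x hx hx'
    exact (mem_sdiff.mp (mem_inter.mp hx').1).2 (mem_sdiff.mp (mem_inter.mp hx).1).1
  have hdU : Disjoint S1U S2U := by
    rw [disjoint_left]; intro x hx hx'
    exact (mem_sdiff.mp (mem_inter.mp (mem_erase.mp hx').2).1).2 (mem_sdiff.mp (mem_inter.mp (mem_erase.mp hx).2).1).1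
  -- CASE ANALYSIS
  rcases hcase with ⟨h2V, h2U⟩ | ⟨h1U, h2U⟩ | ⟨h1V, h2V⟩ | ⟨h1V, h2V, h2U, h1U⟩
  · -- Case I: no bad source of type 2 anywhere
    have hS2V0 : S2V.card = 0 := by rw [h2V, card_empty]
    have hS2U0 : S2U.card = 0 := by rw [h2U, card_empty]
    by_cases h1V : S1V.Nonempty
    · -- a type-1 source on the `Q`-arm puts the whole `P`-target row into `A`
      have hAPt' : APt = univ := hAQP (h1V.mono hS1V_sub_A)
      -- one-type Hall on the `Q`-arm
      have hV : S1V.card ≤ XQ1.card + XQ3.card := by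
        have h := hXQ AQb ∅ hAQb hemptyQ
        simp only [sdiff_empty, empty_sdiff, empty_inter, inter_empty, card_empty, add_zero] at h
        have e1 : S1V.card ≤ (AQb ∩ (DQ \ BQ)).card :=
          card_le_card (fun x hx => mem_inter.mpr ⟨(mem_sdiff.mp (mem_inter.mp hx).1).1, (mem_inter.mp hx).2⟩)
        have e2 : (AQb ∩ T1Q).card ≤ (AQt ∩ T1Q).card := card_le_card (inter_subset_inter hAQ subset_rfl)
        have e3 : (AQt ∩ T1Q).card ≤ XQ1.card + XQ3.card := by
          refine le_trans (card_le_card ?_) (card_union_le XQ1 XQ3)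
          intro x hx
          obtain ⟨hxA, hxT⟩ := mem_inter.mp hx
          by_cases hxC : x ∈ CQt
          · exact mem_union.mpr (Or.inr (mem_inter.mpr ⟨mem_inter.mpr ⟨hxA, hxC⟩, hT1Q hxT⟩))
          · exact mem_union.mpr (Or.inl (mem_inter.mpr ⟨mem_sdiff.mpr ⟨hxA, hxC⟩, hxT⟩))
        omega
      -- one-type Hall on the `P`-arm (corner and apex removed)
      have hU : S1U.card ≤ (XP1.erase tP).card + (XP3.erase tP).card := by
        have e1 : S1U.card ≤ (DP.erase bP).card := card_le_card (erase_subset_erase bP (fun x hx =>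
          (mem_sdiff.mp (mem_inter.mp hx).2).1))
        have e2 : (DP.erase bP).card = (T1P.erase tP).card := by
          have hc : T1P.card = DP.card := by rw [eT1P]; exact card_filter_mirror cP hcP DP
          have hiff : tP ∈ T1P ↔ bP ∈ DP := by rw [eT1P]; exact top_mem_filter_mirror_iff cP hcP hcPb DP
          by_cases hb : bP ∈ DP
          · have h1 := card_erase_add_one hb
            have h2 := card_erase_add_one (hiff.mpr hb)
            omega
          · rw [erase_eq_of_notMem hb, erase_eq_of_notMem (fun h => hb (hiff.mp h)), hc]
        have e3 : (T1P.erase tP).card ≤ (XP1.erase tP).card + (XP3.erase tP).card := by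
          refine le_trans (card_le_card ?_) (card_union_le _ _)
          intro x hx
          obtain ⟨hxt, hxT⟩ := mem_erase.mp hx
          have hxA : x ∈ APt := by rw [hAPt']; exact mem_univ _
          by_cases hxC : x ∈ CPt
          · exact mem_union.mpr (Or.inr (mem_erase.mpr ⟨hxt, mem_inter.mpr ⟨mem_inter.mpr ⟨hxA, hxC⟩, hT1P hxT⟩⟩))
          · exact mem_union.mpr (Or.inl (mem_erase.mpr ⟨hxt, mem_inter.mpr ⟨mem_sdiff.mpr ⟨hxA, hxC⟩, hxT⟩⟩))
        omega
      omega
    · -- no source on the `Q`-arm: the apex may serve the `P`-arm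
      have hS1V0 : S1V.card = 0 := by rw [not_nonempty_iff_eq_empty.mp h1V, card_empty]
      omega
  · -- Case II.a: both types on the `P`-arm ⇒ the whole `Q`-column lies in `A ∩ C`, one unit of slack there
    have hAQt' : AQt = univ := hAPQ (h1U.mono hS1U_sub_A)
    have hCQt' : CQt = univ := hCPQ (h2U.mono hS2U_sub_C)
    have hXQ3' : XQ3 = NEQ := by rw [hXQ3, hAQt', hCQt', univ_inter, univ_inter]
    have hbDQ : bQ ∈ DQ := hDc.mp (bot_mem_of_lower_nonempty hDPl hbP (h1U.mono hS1U_sub_D))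
    have hbBQ : bQ ∈ BQ := hBc.mp (bot_mem_of_lower_nonempty hBPl hbP (h2U.mono hS2U_sub_B))
    have htX : tQ ∈ XQ3 := by rw [hXQ3']; exact mem_erase.mpr ⟨fun h => hbtQ h.symm, mem_univ _⟩
    have hLV : S1V.card + S2V.card + 1 ≤ XQ3.card := by
      rw [← card_union_of_disjoint hdV, ← card_erase_add_one htX]
      refine Nat.add_le_add_right (card_le_card ?_) 1
      intro x hx
      rw [hXQ3']
      rcases mem_union.mp hx with hx | hx
      · obtain ⟨hxD, hxB⟩ := mem_sdiff.mp (mem_inter.mp hx).2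
        exact mem_erase.mpr ⟨fun h => hDQt (h ▸ hxD), mem_erase.mpr ⟨fun h => hxB (h ▸ hbBQ), mem_univ _⟩⟩
      · obtain ⟨hxB, hxD⟩ := mem_sdiff.mp (mem_inter.mp hx).2
        exact mem_erase.mpr ⟨fun h => hBQt (h ▸ hxB), mem_erase.mpr ⟨fun h => hxD (h ▸ hbDQ), mem_univ _⟩⟩
    omega
  · -- Case II.b: both types on the `Q`-arm ⇒ the whole `P`-row lies in `A ∩ C`
    have hAPt' : APt = univ := hAQP (h1V.mono hS1V_sub_A)
    have hCPt' : CPt = univ := hCQP (h2V.mono hS2V_sub_C)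
    have hXP3' : XP3 = NEP := by rw [hXP3, hAPt', hCPt', univ_inter, univ_inter]
    have hLU : S1U.card + S2U.card ≤ (XP3.erase tP).card := by
      rw [← card_union_of_disjoint hdU]
      refine card_le_card ?_
      intro x hx
      rw [hXP3']
      rcases mem_union.mp hx with hx | hx
      · obtain ⟨hxb, hx'⟩ := mem_erase.mp hx
        have hxD : x ∈ DP := (mem_sdiff.mp (mem_inter.mp hx').2).1
        exact mem_erase.mpr ⟨fun h => hDPt (h ▸ hxD), mem_erase.mpr ⟨hxb, mem_univ _⟩⟩
      · obtain ⟨hxb, hx'⟩ := mem_erase.mp hx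
        have hxB : x ∈ BP := (mem_sdiff.mp (mem_inter.mp hx').2).1
        exact mem_erase.mpr ⟨fun h => hBPt (h ▸ hxB), mem_erase.mpr ⟨hxb, mem_univ _⟩⟩
    omega
  · -- Case II.c: type 1 only on the `Q`-arm, type 2 only on the `P`-arm
    have hS2V0 : S2V.card = 0 := by rw [h2V, card_empty]
    have hS1U0 : S1U.card = 0 := by rw [h1U, card_empty]
    have hAPt' : APt = univ := hAQP (h1V.mono hS1V_sub_A)
    have hCQt' : CQt = univ := hCPQ (h2U.mono hS2U_sub_C)
    -- the `Q`-arm has one unit of slack: its fibre `A₀` contains `t_Q ∉ D_Q` but not `b_Q`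
    have hbA : bQ ∉ AQb := by
      intro hb
      have hAPb' : APb = univ := upper_eq_univ_of_bot_mem hAPb hbP (hA00.mp hb)
      obtain ⟨x, hx⟩ := h2U
      have hx' := (mem_sdiff.mp (mem_inter.mp (mem_erase.mp hx).2).1).2
      rw [hAPb'] at hx'
      exact hx' (mem_univ x)
    have htA : tQ ∈ AQb := top_mem_of_upper_nonempty hAQb htQ (h1V.mono hS1V_sub_A)
    have hV : S1V.card + 1 ≤ XQ3.card := by
      have e1 : S1V ⊆ AQb.erase tQ := fun x hx =>
        mem_erase.mpr ⟨fun h => hDQt (h ▸ (mem_sdiff.mp (mem_inter.mp hx).2).1), hS1V_sub_A hx⟩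
      have e2 : (AQb.erase tQ).card + 1 = AQb.card := card_erase_add_one htA
      have e3 : AQb ⊆ XQ3 := fun x hx => by
        rw [hXQ3, hCQt']
        exact mem_inter.mpr ⟨mem_inter.mpr ⟨hAQ hx, mem_univ _⟩, mem_erase.mpr ⟨fun h => hbA (h ▸ hx), mem_univ _⟩⟩
      have := card_le_card e1
      have := card_le_card e3
      omega
    -- the `P`-arm is at most one short (the apex): one-type Hall for type 2
    have hU : S2U.card ≤ (XP3.erase tP).card + 1 := by
      have h := hXP ∅ CPb hemptyP hCPb
      simp only [sdiff_empty, empty_sdiff, empty_inter, card_empty, zero_add] at h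
      have e1 : S2U.card ≤ (CPb ∩ (BP \ DP)).card := le_trans card_erase_le
        (card_le_card (fun x hx => mem_inter.mpr ⟨(mem_sdiff.mp (mem_inter.mp hx).1).1, (mem_inter.mp hx).2⟩))
      have e2 : (CPb ∩ T2P).card ≤ (CPb ∩ NEP).card := card_le_card (inter_subset_inter subset_rfl hT2P)
      have e3 : CPb ∩ NEP ⊆ XP3 := fun x hx => by
        rw [hXP3, hAPt']
        exact mem_inter.mpr ⟨mem_inter.mpr ⟨mem_univ _, hCP (mem_inter.mp hx).1⟩, (mem_inter.mp hx).2⟩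
      have e4 : ((CPb ∩ NEP).erase tP).card ≤ (XP3.erase tP).card := card_le_card (erase_subset_erase tP e3)
      have e5 : (CPb ∩ NEP).card ≤ ((CPb ∩ NEP).erase tP).card + 1 := by
        rw [card_erase_eq_ite]; split_ifs <;> omega
      omega
    omega


end Summit.CriticalPhenomena.PercolationContinuityZ3.Theorems.Coefficientwise.TwoArms
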